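import Summits.QuantumFields.YangMills.Theorems.BalabanUVNodesN21GappedTopPairReading13CoPHSignFree
import Summits.QuantumFields.YangMills.Theorems.BalabanUVNodesN21GappedTopPairReading13CoPHCmapExtraction

/-!
# N21's DOUBLY-GAPPED SPINE READING, χ-GENERIC («Cmap») — THE SIGN-FREE SHELL BOUND (`ShellWeightBound`) AT ITS CARRIERS AND AT THE READING ON THE LIVE LINE, v8's
# `KeyedShellWeight` CONJUNCT ON THE GAP-PINNED SPLIT READING (any cut reading), AND THE STUB-2 BILL REDUCED TO THE DIAL ROWS + N19′'s CORE + NODE U5's TARGET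

Cell `pub-ymgap` (HUMAN RULING D-0062, Track A), seat `pub-ymgap-dag-n20-d` (gen 46; R134 (a) N20 s3; op-5c-class K3ᴬ supply, `--kind proof --supports stmt-QuantumFields-27247 --as helper`;
count-neutral; proves NO registered stub).  CROSS-LANE χ-TWIN, declared as such: the parents are dag-n21-w7's `Thm/BalabanUVNodesN21GappedTopPairReading13CoPHSignFree`
(`sum_topGap2ShellAtLevel_grids_le_majorants_of_liveSel`, ★★★ `gap2ShellSum_selDepths_le_signFree`, `shellWeightBound_carriersGap2₁₃_signFree`, `shellWeightBound_crGap2₁₃VAt_signFree`) and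
dag-n21-d's `…Reading13CoPH` (`sum_range_majorantA2∕B2AtLevel_le_of_liveSel`), RE-KEYED over the β-slot exactly as this lineage's `…CmapExtraction` (✓p813745) and dag-n15-a's `…DefsCmap`
(`majA2∕B2SumA∕B₁₃Chi`, `a∕bBadness2₁₃Chi`, `selDepthA2∕B2₁₃Chi(_spec)`, `gap2ShellSumA∕B₁₃Chi`, `gapShell2A∕B₁₃Chi`, `crGap2₁₃VAtCmap`); proofs through the parents' DATUM-GENERIC lemmas
(`sum_topGap2ShellAt_grids_le_majorants`, `topGap2ShellAtLevel_grids_nonneg ∕ _le`, `majorantA2∕B2AtLevel_grid_nonneg`, `sum_range_majorantA_le`, `sum_range_majorantB_seq_le`,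
`argmin_badness_bounds`) — (H-ζ) is the provisos' ROW `zetaMeas`, positivity of the χ-datum's partition functions ✓p813406 `schemeZ_pos_datumOfRecord₁₃CoPHChi`.  No n21 ∕ n27 ∕ n19 seat has
been on the bus since 2026-08-31T00:32Z.
[III] = [Balaban1988Convergent], [LF-I] = [Balaban1989LargeFieldI], [LF-II] = [Balaban1989LargeFieldII].

CONTENTS.  §1 θ-level χ-lemmas on the live line: `sum_topGap2ShellAtLevel_grids_le_majorants_of_liveSel_chi`, `sum_range_majorantA2AtLevel_le_of_liveSel_chi`,
`sum_range_majorantB2AtLevel_le_of_liveSel_chi`.  §2 ★★★ `gap2ShellSum_selDepths_le_signFree_chi` — both runs' two-collar shell masses at the SEPARATELY selected depth pair are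
`≤ 4(2L^m)⁴(1∕(n₁+1) + 1∕(n₂+1)) ×` the runs' χ-datum partition functions; rows `hsel`, `0 ≤ ρ_K, ρ′_K ≤ 1` ONLY (pigeonhole on the a- and b-majorants, no anti-concentration, no sign
rows).  §3 `sum_classSet₁₃Chi_gapShell2A∕B₁₃Chi` (fibre sums) · ★★★ `shellWeightBound_carriersGap2₁₃Chi_signFree` · ★★ `shellWeightBound_crGap2₁₃VAtCmap_signFree` (at the reading's
canonical `Wsh`, any `Χ K₀ jcut`).  §4 AT THE MIRROR (`N = 2`, re-centred): ★★★ `keyedShell_extraction_of_liveGap2Pin` — v8's OWN pin (ANY cut reading) + the off-live pin + the dial rows AT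
THE TUPLE ⟹ `KeyedShellWeight cr ∧ KeyedExtractionV cr`; ★★ `exists_gap2PinnedSplitReading_threeFaces_cutZero` (∃ cr: pin at `jc ≡ 0` ∧ off-live pin ∧ `KeyedRelWeight cr ∧
KeyedShellWeight cr ∧ KeyedExtractionV cr` from `DialRows ρ ρ′ n₁ n₂` alone).  §5 ★★★ THE BILL `stub2Text_of_dialRows_liveCore_cutZero`: per `β` and guarded K4-faced reading, dials
with `DialRows` + N19′'s slot-keyed `NE7.Core` at `crGap2₁₃VAx (fun _ ↦ 0) ρ ρ′ n₁ n₂` ON THE LIVE LINE + node U5's `Target` at the datum OFF it ⟹ THE REGISTERED STUB-2 TEXT (byte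
for byte).  After this file a v8 stub-2 closer at the zero cut owes EXACTLY: the dial rows (any widths in `[0,1]`, any depths with `Σ_K (1∕(n₁ K+1) + 1∕(n₂ K+1)) < ∞`), N19′'s core on
ALL keyed classes of the cut-zero doubly-gapped RE-CENTRED reading on the live line (NE7 proper — NOT PRINTED for `d = 4`), and node U5's target off the line (NOT PRINTED) — the pin,
N20, N21 and N27x are paid BY NAME.

HONEST FRAMING.  [folklore] pigeonhole ∕ Fubini ∕ fibre-sum bookkeeping BY NAME on the parents' datum-generic lemmas; NO estimate of Bałaban's ((3.2)∕(3.3) two-collar shells are the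
tree's own device under [LF-I] p.181's re-lettering freedom, their smallness a COUNT, not an analytic bound); §5's core and target are the OTHER lanes' content, HYPOTHESES asserted for
no family; NO stub of K3ᴬ v8 is closed or claimed (0∕2); no `Provisos₁₃CoPHChi ∕ …Ax` inhabitant claimed (K0ᴬ OPEN); N19 ∕ N20 ∕ N21 ∕ N27 NOT discharged; counts UNMOVED (typed 28∕28 ·
discharged 8∕27 · A 8∕28 · K 1∕4).  One finite `𝕋⁴_{L^K}` programme at fixed `ε = L^{−K}`, Bałaban AS PRINTED — NOT ℝ⁴, NOT infinite volume, NOT OS, NOT a mass gap; the YM mass gap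
(Clay) is NOT proved by any of this.  No `def`, no `instance`, no `notation`, no `sorry`, standard axioms.
Sources (locators, bookkeeping only): [III] (2.17)–(2.18) p.257, (3.2)–(3.3) p.265, (3.16) p.268; [LF-I] (0.3)–(0.4) p.176, p.181; [LF-II] Thm 1 + (0.1) pp.355–356, (1.80) p.384;
[King1986] (3.10)–(3.11) p.656.
-/

set_option autoImplicit false

noncomputable section

open scoped BigOperators
open Finset MeasureTheory

namespace Summit.QuantumFields.YangMills.Theorems.N21GappedTopPair13CoPH

open Literature.MathematicalPhysics.QuantumFieldTheory.Balaban1983to89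
open Literature.MathematicalPhysics.QuantumFieldTheory.Balaban1983to89.T4Continuum
open Literature.MathematicalPhysics.QuantumFieldTheory.Balaban1983to89.Node00
open Literature.MathematicalPhysics.QuantumFieldTheory.Balaban1983to89.T4ContinuumYM4Torus (ForSmallCouplings)
open Summit.QuantumFields.BalabanUV.T4Continuum.Spine
open T4IndicatorShell (ShellWeightBound)
open T4WeightBudget (RelWeightBound)
open YMDAG.UVSplit (runA₁₃ runB₁₃ keyA₁₃Chi keyB₁₃Chi histA₁₃Chi histB₁₃Chi histA₁₃Chi_zero histB₁₃Chi_zero classSet₁₃Chi badClass₁₃Chi SpineReading₁₃CoPHCmap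
  SpineReading₁₃CoPHAx classSet₁₃Ax badClass₁₃Ax)
open Summit.QuantumFields.YangMills.BalabanUVNodes.SpineCanonicalWeights
open Summit.QuantumFields.YangMills.Theorems.N21StepWeightsPositivity (zetaOfRecord_nonneg)
open Summit.QuantumFields.YangMills.BalabanUVNodes.N19MGFFormAtRecordMass (sum_classWeightOfDatum₉_eq_schemeZ_of_ppSelLive_of_localBg)
open Summit.QuantumFields.YangMills.Theorems.N21ShellSplitOfRecord13CoPH
open Summit.QuantumFields.YangMills.Theorems.K3AxV8Defs
open Summit.QuantumFields.YangMills.BalabanUVNodes.N20OffLiveOneTermReadingCmap (schemeZ_pos_datumOfRecord₁₃CoPHChi crOneTerm₁₃Ax exists_reading_livePin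
  keyedRelWeight_of_liveGap2Pin_cutZero keyedShellWeight_of_livePin keyedCoreEdgeHolderD4V_of_livePin)

variable {F : T4Family} {N : ℕ} [NeZero N]

/-! ## §1 θ-level χ-lemmas on the live-selector line -/

section LiveChi

variable (θ : Stage13HParams F N) (χ : ChiSlot F N) (hP : θ.Provisos₁₃CoPHChi F N χ) (E : B12.RunParams → ℝ)
  (hsel : θ.ppSel = ppSelLiveOfRecord F N θ.ν θ.τ9 E (wOfRecord₉ F N θ.toStage9Params)) (g₀ : ℕ → ℝ) (os : List (ULoop F))
include hsel

/-- ★★ **THE TWO-COLLAR SHELLS SUMMED OVER THE TOP HISTORIES ARE BELOW THE a-MAJORANT PLUS THE b-MAJORANT, AT EVERY LEVEL, ALONG THE GRIDS, SIGN-FREE** — χ-twin of the parent's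
`sum_topGap2ShellAtLevel_grids_le_majorants_of_liveSel` (datum-generic `sum_topGap2ShellAt_grids_le_majorants` at the χ-datum). [cite: Balaban1988Convergent, (2.17) p.257, (3.2)–(3.3) p.265 (bookkeeping)] -/
theorem sum_topGap2ShellAtLevel_grids_le_majorants_of_liveSel_chi {p : B12.RunParams} {g : ℕ → ℝ} (hg : g 0 = g₀ p.K) {ρ ρ' : ℝ} (hρ0 : 0 ≤ ρ) (hρ1 : ρ ≤ 1)
    (hρ'0 : 0 ≤ ρ') (hρ'1 : ρ' ≤ 1) (ja kb i j : ℕ) (t : ℝ) :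
    ∀ j' : ℕ, j' = p.K → ∑ s, topGap2ShellAtLevel F N θ.toStage9Params (datumOfRecord₁₃CoPHChi F N θ χ hP) g₀ os p g (cutGrid θ.ν g ja ρ (i + 2)) (cutGrid θ.ν g ja ρ (i + 1))
        (cutGrid θ.ν g ja ρ i) (bCutGrid θ.ν θ.A₁ g kb ρ' (j + 2)) (bCutGrid θ.ν θ.A₁ g kb ρ' (j + 1)) (bCutGrid θ.ν θ.A₁ g kb ρ' j) t j' s ≤
      majorantA2AtLevel F N θ.toStage9Params (datumOfRecord₁₃CoPHChi F N θ χ hP) g₀ os p g (cutGrid θ.ν g ja ρ (i + 2)) (cutGrid θ.ν g ja ρ i) t j' +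
        majorantB2AtLevel F N θ.toStage9Params (datumOfRecord₁₃CoPHChi F N θ χ hP) g₀ os p g (bCutGrid θ.ν θ.A₁ g kb ρ' (j + 2)) (bCutGrid θ.ν θ.A₁ g kb ρ' j) t j' := by
  have hζ0 : ∀ p g k s Pl Ql RS U V', 0 ≤ θ.ζ p g k s Pl Ql RS U V' :=
    fun p g k s Pl Ql RS U V' => zetaOfRecord_nonneg F N θ.ν θ.τ9.M hP.zetaUnity hP.zetaAbs p g k s Pl Ql RS U V'
  have hU : LocalBgMeasurable F N θ.ν := localBgMeasurable F N θ.ν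
  have hD : (datumOfRecord₁₃CoPHChi F N θ χ hP).AvgMeasurable := (isPrintedAveraged_datumOfRecord₁₃CoPH_chi F N θ χ hP).avgMeasurable
  intro j' hj'
  cases j' with
  | zero => simp
  | succ k =>
    simp only [topGap2ShellAtLevel_succ, majorantA2AtLevel_succ, majorantB2AtLevel_succ]
    exact sum_topGap2ShellAt_grids_le_majorants F N θ.toStage9Params (datumOfRecord₁₃CoPHChi F N θ χ hP) g₀ os p g k hj' hζ0 hP.zetaMeas hP.zetaAbs hP.zetaUnity hρ0 hρ1
      hρ'0 hρ'1 ja kb i j t (fun s => integrable_chi_mul_dressedSlots_of_ppSelLive θ.toStage9Params E hsel hU hP.zetaMeas hζ0 hP.zetaAbs _ hD g₀ os hg t k s)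

/-- ★ **THE a-MAJORANT COUNT AT EVERY LEVEL** — `Σ_{i<m} Mᵃ(grid collar i) ≤ 2(2L^m)⁴ · Z` on the live line; χ-twin of the parent's `sum_range_majorantA2AtLevel_le_of_liveSel`.
[cite: Balaban1988Convergent, (2.17) p.257 (bookkeeping)] -/
theorem sum_range_majorantA2AtLevel_le_of_liveSel_chi {p : B12.RunParams} {g : ℕ → ℝ} (hg : g 0 = g₀ p.K) (ρ : ℝ) (m : ℕ) (t : ℝ) :
    ∀ j : ℕ, j = p.K → ∑ i ∈ Finset.range m, majorantA2AtLevel F N θ.toStage9Params (datumOfRecord₁₃CoPHChi F N θ χ hP) g₀ os p g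
        (cutGrid θ.ν g j ρ (i + 2)) (cutGrid θ.ν g j ρ i) t j ≤
      2 * (2 * (F.L : ℝ) ^ F.m) ^ 4 * T4GenFunBounds.schemeZ ((datumOfRecord₁₃CoPHChi F N θ χ hP).scheme g₀) os p.K t := by
  have hζ0 : ∀ p g k s Pl Ql RS U V', 0 ≤ θ.ζ p g k s Pl Ql RS U V' :=
    fun p g k s Pl Ql RS U V' => zetaOfRecord_nonneg F N θ.ν θ.τ9.M hP.zetaUnity hP.zetaAbs p g k s Pl Ql RS U V'
  have hU : LocalBgMeasurable F N θ.ν := localBgMeasurable F N θ.ν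
  have hD : (datumOfRecord₁₃CoPHChi F N θ χ hP).AvgMeasurable := (isPrintedAveraged_datumOfRecord₁₃CoPH_chi F N θ χ hP).avgMeasurable
  have hZ0 : 0 ≤ T4GenFunBounds.schemeZ ((datumOfRecord₁₃CoPHChi F N θ χ hP).scheme g₀) os p.K t := (schemeZ_pos_datumOfRecord₁₃CoPHChi θ χ hP g₀ os p.K t).le
  intro j hj
  cases j with
  | zero =>
    simp only [majorantA2AtLevel_zero, Finset.sum_const_zero]
    exact mul_nonneg (by positivity) hZ0
  | succ k =>
    simp only [majorantA2AtLevel_succ]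
    rw [← sum_classWeightOfDatum₉_eq_schemeZ_of_ppSelLive_of_localBg θ.toStage9Params E hsel hg hU hP.zetaMeas hζ0 hP.zetaAbs hP.zetaUnity
      (datumOfRecord₁₃CoPHChi F N θ χ hP) hD os t k (by omega)]
    exact sum_range_majorantA_le F N θ.toStage9Params (datumOfRecord₁₃CoPHChi F N θ χ hP) g₀ os p g k hj hζ0 ρ m t
      (fun s => integrable_chi_mul_dressedSlots_of_ppSelLive θ.toStage9Params E hsel hU hP.zetaMeas hζ0 hP.zetaAbs _ hD g₀ os hg t k s)

/-- ★ **THE b-MAJORANT COUNT AT EVERY LEVEL** along ANY letter sequence `x` — `Σ_{j<m} Mᵇ([x_{j+2}, x_j)) ≤ 2(2L^m)⁴ · Z` on the live line; χ-twin of the parent's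
`sum_range_majorantB2AtLevel_le_of_liveSel`. [cite: Balaban1988Convergent, (2.17) p.257, (3.3) p.265 (bookkeeping)] -/
theorem sum_range_majorantB2AtLevel_le_of_liveSel_chi {p : B12.RunParams} {g : ℕ → ℝ} (hg : g 0 = g₀ p.K) (x : ℕ → ℝ) (m : ℕ) (t : ℝ) :
    ∀ j : ℕ, j = p.K → ∑ j' ∈ Finset.range m, majorantB2AtLevel F N θ.toStage9Params (datumOfRecord₁₃CoPHChi F N θ χ hP) g₀ os p g (x (j' + 2)) (x j') t j ≤
      2 * (2 * (F.L : ℝ) ^ F.m) ^ 4 * T4GenFunBounds.schemeZ ((datumOfRecord₁₃CoPHChi F N θ χ hP).scheme g₀) os p.K t := by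
  have hζ0 : ∀ p g k s Pl Ql RS U V', 0 ≤ θ.ζ p g k s Pl Ql RS U V' :=
    fun p g k s Pl Ql RS U V' => zetaOfRecord_nonneg F N θ.ν θ.τ9.M hP.zetaUnity hP.zetaAbs p g k s Pl Ql RS U V'
  have hU : LocalBgMeasurable F N θ.ν := localBgMeasurable F N θ.ν
  have hD : (datumOfRecord₁₃CoPHChi F N θ χ hP).AvgMeasurable := (isPrintedAveraged_datumOfRecord₁₃CoPH_chi F N θ χ hP).avgMeasurable
  have hZ0 : 0 ≤ T4GenFunBounds.schemeZ ((datumOfRecord₁₃CoPHChi F N θ χ hP).scheme g₀) os p.K t := (schemeZ_pos_datumOfRecord₁₃CoPHChi θ χ hP g₀ os p.K t).le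
  intro j hj
  cases j with
  | zero =>
    simp only [majorantB2AtLevel_zero, Finset.sum_const_zero]
    exact mul_nonneg (by positivity) hZ0
  | succ k =>
    simp only [majorantB2AtLevel_succ]
    rw [← sum_classWeightOfDatum₉_eq_schemeZ_of_ppSelLive_of_localBg θ.toStage9Params E hsel hg hU hP.zetaMeas hζ0 hP.zetaAbs hP.zetaUnity
      (datumOfRecord₁₃CoPHChi F N θ χ hP) hD os t k (by omega)]
    exact sum_range_majorantB_seq_le F N θ.toStage9Params (datumOfRecord₁₃CoPHChi F N θ χ hP) g₀ os p g k hj hζ0 x m t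
      (fun s => integrable_chi_mul_dressedSlots_of_ppSelLive θ.toStage9Params E hsel hU hP.zetaMeas hζ0 hP.zetaAbs _ hD g₀ os hg t k s)

end LiveChi

/-! ## §2 At the doubly-gapped χ-carriers: the bound at the two SEPARATELY selected depths, sign-free -/

/-- ★★★ **BOTH RUNS' TWO-COLLAR SHELL MASSES AT THE SELECTED DEPTH PAIR `(i⋆, j⋆)` ARE `≤ 4(2L^m)⁴(1∕(n₁+1) + 1∕(n₂+1)) ×` THE RUNS' χ-DATUM PARTITION FUNCTIONS — SIGN-FREE**;
rows: `hsel`, `0 ≤ ρ_K, ρ′_K ≤ 1` (the provisos carry (H-ζ)).  χ-twin of dag-n21-w7's `gap2ShellSum_selDepths_le_signFree` (`argmin_badness_bounds` on the two runs' a-majorants and,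
INDEPENDENTLY, on their b-majorants).  NO anti-concentration, NO estimate of Bałaban's. [cite: Balaban1988Convergent, (2.17)–(2.18) p.257, (3.2)–(3.3) p.265 (bookkeeping)] -/
theorem gap2ShellSum_selDepths_le_signFree_chi (K₀ : ℕ) (θ : Stage13HParams F N) (χ : ChiSlot F N) (hP : θ.Provisos₁₃CoPHChi F N χ) (g₀ : ℕ → ℝ) (os : List (ULoop F))
    (E : B12.RunParams → ℝ) (hsel : θ.ppSel = ppSelLiveOfRecord F N θ.ν θ.τ9 E (wOfRecord₉ F N θ.toStage9Params))
    {ρ ρ' : ℕ → ℝ} (hρ0 : ∀ K, 0 ≤ ρ K) (hρ1 : ∀ K, ρ K ≤ 1) (hρ'0 : ∀ K, 0 ≤ ρ' K) (hρ'1 : ∀ K, ρ' K ≤ 1) (n₁ n₂ K : ℕ) (t : ℝ) :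
    gap2ShellSumA₁₃Chi θ χ hP K₀ g₀ os ρ ρ' K (selDepthA2₁₃Chi θ χ hP K₀ g₀ os ρ n₁ K t) (selDepthB2₁₃Chi θ χ hP K₀ g₀ os ρ' n₂ K t) t ≤
        4 * (2 * (F.L : ℝ) ^ F.m) ^ 4 * (1 / (n₁ + 1 : ℕ) + 1 / (n₂ + 1 : ℕ)) * T4GenFunBounds.schemeZ ((datumOfRecord₁₃CoPHChi F N θ χ hP).scheme g₀) os (K₀ + K) t ∧
      gap2ShellSumB₁₃Chi θ χ hP K₀ g₀ os ρ ρ' K (selDepthA2₁₃Chi θ χ hP K₀ g₀ os ρ n₁ K t) (selDepthB2₁₃Chi θ χ hP K₀ g₀ os ρ' n₂ K t) t ≤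
        4 * (2 * (F.L : ℝ) ^ F.m) ^ 4 * (1 / (n₁ + 1 : ℕ) + 1 / (n₂ + 1 : ℕ)) *
          T4GenFunBounds.schemeZ ((datumOfRecord₁₃CoPHChi F N θ χ hP).scheme g₀) os (K₀ + K + 1) t := by
  set X : ℝ := (2 * (F.L : ℝ) ^ F.m) ^ 4 with hX
  set ZA : ℝ := T4GenFunBounds.schemeZ ((datumOfRecord₁₃CoPHChi F N θ χ hP).scheme g₀) os (K₀ + K) t with hZA
  set ZB : ℝ := T4GenFunBounds.schemeZ ((datumOfRecord₁₃CoPHChi F N θ χ hP).scheme g₀) os (K₀ + K + 1) t with hZB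
  set i := selDepthA2₁₃Chi θ χ hP K₀ g₀ os ρ n₁ K t with hi
  set j := selDepthB2₁₃Chi θ χ hP K₀ g₀ os ρ' n₂ K t with hj
  have hζ0 : ∀ p g k s Pl Ql RS U V', 0 ≤ θ.ζ p g k s Pl Ql RS U V' :=
    fun p g k s Pl Ql RS U V' => zetaOfRecord_nonneg F N θ.ν θ.τ9.M hP.zetaUnity hP.zetaAbs p g k s Pl Ql RS U V'
  -- the two partition functions are nonnegative
  have hZA0 : 0 ≤ ZA := (schemeZ_pos_datumOfRecord₁₃CoPHChi θ χ hP g₀ os (K₀ + K) t).le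
  have hZB0 : 0 ≤ ZB := (schemeZ_pos_datumOfRecord₁₃CoPHChi θ χ hP g₀ os (K₀ + K + 1) t).le
  -- the four majorant families: their signs and their counts
  have hfaA0 : ∀ i, 0 ≤ majA2SumA₁₃Chi θ χ hP K₀ g₀ os ρ K i t := fun i =>
    majorantA2AtLevel_grid_nonneg F N θ.toStage9Params (datumOfRecord₁₃CoPHChi F N θ χ hP) g₀ os _ _ hζ0 _ (hρ0 K) (hρ1 K) i t _
  have hfaB0 : ∀ i, 0 ≤ majA2SumB₁₃Chi θ χ hP K₀ g₀ os ρ K i t := fun i =>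
    majorantA2AtLevel_grid_nonneg F N θ.toStage9Params (datumOfRecord₁₃CoPHChi F N θ χ hP) g₀ os _ _ hζ0 _ (hρ0 K) (hρ1 K) i t _
  have hfbA0 : ∀ j, 0 ≤ majB2SumA₁₃Chi θ χ hP K₀ g₀ os ρ' K j t := fun j =>
    majorantB2AtLevel_grid_nonneg F N θ.toStage9Params (datumOfRecord₁₃CoPHChi F N θ χ hP) g₀ os _ _ hζ0 _ (hρ'0 K) (hρ'1 K) j t _
  have hfbB0 : ∀ j, 0 ≤ majB2SumB₁₃Chi θ χ hP K₀ g₀ os ρ' K j t := fun j =>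
    majorantB2AtLevel_grid_nonneg F N θ.toStage9Params (datumOfRecord₁₃CoPHChi F N θ χ hP) g₀ os _ _ hζ0 _ (hρ'0 K) (hρ'1 K) j t _
  have hsaA : ∑ i ∈ Finset.range (n₁ + 1), majA2SumA₁₃Chi θ χ hP K₀ g₀ os ρ K i t ≤ 2 * X * ZA := by
    have h := sum_range_majorantA2AtLevel_le_of_liveSel_chi θ χ hP E hsel g₀ os (p := runA₁₃ F K₀ g₀ K) (histA₁₃Chi_zero θ χ K₀ g₀ K) (ρ K) (n₁ + 1) t (K₀ + K) rfl
    rw [YMDAG.UVSplit.runA₁₃_K] at h; exact h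
  have hsaB : ∑ i ∈ Finset.range (n₁ + 1), majA2SumB₁₃Chi θ χ hP K₀ g₀ os ρ K i t ≤ 2 * X * ZB := by
    have h := sum_range_majorantA2AtLevel_le_of_liveSel_chi θ χ hP E hsel g₀ os (p := runB₁₃ F K₀ g₀ K) (histB₁₃Chi_zero θ χ K₀ g₀ K) (ρ K) (n₁ + 1) t
      (K₀ + K + 1) rfl
    rw [YMDAG.UVSplit.runB₁₃_K] at h; exact h
  have hsbA : ∑ j ∈ Finset.range (n₂ + 1), majB2SumA₁₃Chi θ χ hP K₀ g₀ os ρ' K j t ≤ 2 * X * ZA := by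
    have h := sum_range_majorantB2AtLevel_le_of_liveSel_chi θ χ hP E hsel g₀ os (p := runA₁₃ F K₀ g₀ K) (histA₁₃Chi_zero θ χ K₀ g₀ K)
      (bCutGrid θ.ν θ.A₁ (histA₁₃Chi θ χ K₀ g₀ K) (K₀ + K - 1) (ρ' K)) (n₂ + 1) t (K₀ + K) rfl
    rw [YMDAG.UVSplit.runA₁₃_K] at h; exact h
  have hsbB : ∑ j ∈ Finset.range (n₂ + 1), majB2SumB₁₃Chi θ χ hP K₀ g₀ os ρ' K j t ≤ 2 * X * ZB := by
    have h := sum_range_majorantB2AtLevel_le_of_liveSel_chi θ χ hP E hsel g₀ os (p := runB₁₃ F K₀ g₀ K) (histB₁₃Chi_zero θ χ K₀ g₀ K)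
      (bCutGrid θ.ν θ.A₁ (histB₁₃Chi θ χ K₀ g₀ K) (K₀ + K) (ρ' K)) (n₂ + 1) t (K₀ + K + 1) rfl
    rw [YMDAG.UVSplit.runB₁₃_K] at h; exact h
  -- the two argmins
  have hspecA := selDepthA2₁₃Chi_spec θ χ hP K₀ g₀ os ρ n₁ K t
  have hspecB := selDepthB2₁₃Chi_spec θ χ hP K₀ g₀ os ρ' n₂ K t
  obtain ⟨haA, haB⟩ := argmin_badness_bounds (f := fun i => majA2SumA₁₃Chi θ χ hP K₀ g₀ os ρ K i t) (g := fun i => majA2SumB₁₃Chi θ χ hP K₀ g₀ os ρ K i t)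
    hfaA0 hfaB0 hZA0 hZB0 (by positivity) hsaA hsaB hspecA.1 hspecA.2
  obtain ⟨hbA, hbB⟩ := argmin_badness_bounds (f := fun j => majB2SumA₁₃Chi θ χ hP K₀ g₀ os ρ' K j t) (g := fun j => majB2SumB₁₃Chi θ χ hP K₀ g₀ os ρ' K j t)
    hfbA0 hfbB0 hZA0 hZB0 (by positivity) hsbA hsbB hspecB.1 hspecB.2
  -- `Σ shell2 ≤ Mᵃ + Mᵇ` in each run at the selected letters, sign-free
  have hMA := sum_topGap2ShellAtLevel_grids_le_majorants_of_liveSel_chi θ χ hP E hsel g₀ os (p := runA₁₃ F K₀ g₀ K) (histA₁₃Chi_zero θ χ K₀ g₀ K)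
    (hρ0 K) (hρ1 K) (hρ'0 K) (hρ'1 K) (K₀ + K) (K₀ + K - 1) i j t (K₀ + K) rfl
  have hMB := sum_topGap2ShellAtLevel_grids_le_majorants_of_liveSel_chi θ χ hP E hsel g₀ os (p := runB₁₃ F K₀ g₀ K) (histB₁₃Chi_zero θ χ K₀ g₀ K)
    (hρ0 K) (hρ1 K) (hρ'0 K) (hρ'1 K) (K₀ + K + 1) (K₀ + K) i j t (K₀ + K + 1) rfl
  have hnum : ∀ Z : ℝ, 2 * (2 * X) / ((n₁ + 1 : ℕ) : ℝ) * Z + 2 * (2 * X) / ((n₂ + 1 : ℕ) : ℝ) * Z = 4 * X * (1 / (n₁ + 1 : ℕ) + 1 / (n₂ + 1 : ℕ)) * Z :=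
    fun Z => by ring
  refine ⟨?_, ?_⟩
  · calc gap2ShellSumA₁₃Chi θ χ hP K₀ g₀ os ρ ρ' K i j t
        ≤ majA2SumA₁₃Chi θ χ hP K₀ g₀ os ρ K i t + majB2SumA₁₃Chi θ χ hP K₀ g₀ os ρ' K j t := hMA
      _ ≤ 2 * (2 * X) / ((n₁ + 1 : ℕ) : ℝ) * ZA + 2 * (2 * X) / ((n₂ + 1 : ℕ) : ℝ) * ZA := by
          have h1 : majA2SumA₁₃Chi θ χ hP K₀ g₀ os ρ K i t ≤ 2 * (2 * X) / ((n₁ + 1 : ℕ) : ℝ) * ZA := by simpa using haA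
          have h2 : majB2SumA₁₃Chi θ χ hP K₀ g₀ os ρ' K j t ≤ 2 * (2 * X) / ((n₂ + 1 : ℕ) : ℝ) * ZA := by simpa using hbA
          linarith
      _ = 4 * X * (1 / (n₁ + 1 : ℕ) + 1 / (n₂ + 1 : ℕ)) * ZA := hnum ZA
  · calc gap2ShellSumB₁₃Chi θ χ hP K₀ g₀ os ρ ρ' K i j t
        ≤ majA2SumB₁₃Chi θ χ hP K₀ g₀ os ρ K i t + majB2SumB₁₃Chi θ χ hP K₀ g₀ os ρ' K j t := hMB
      _ ≤ 2 * (2 * X) / ((n₁ + 1 : ℕ) : ℝ) * ZB + 2 * (2 * X) / ((n₂ + 1 : ℕ) : ℝ) * ZB := by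
          have h1 : majA2SumB₁₃Chi θ χ hP K₀ g₀ os ρ K i t ≤ 2 * (2 * X) / ((n₁ + 1 : ℕ) : ℝ) * ZB := by simpa using haB
          have h2 : majB2SumB₁₃Chi θ χ hP K₀ g₀ os ρ' K j t ≤ 2 * (2 * X) / ((n₂ + 1 : ℕ) : ℝ) * ZB := by simpa using hbB
          linarith
      _ = 4 * X * (1 / (n₁ + 1 : ℕ) + 1 / (n₂ + 1 : ℕ)) * ZB := hnum ZB

/-! ## §3 `ShellWeightBound` at the doubly-gapped χ-carriers and at the χ-reading, sign-free -/

section CarriersChi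

variable (K₀ : ℕ) (θ : Stage13HParams F N) (χ : ChiSlot F N) (hP : θ.Provisos₁₃CoPHChi F N χ) (g₀ : ℕ → ℝ) (os : List (ULoop F)) (ρ ρ' : ℕ → ℝ) (n₁ n₂ : ℕ → ℕ)

/-- run A: the class-set sum of the two-collar shell parts is the run's two-collar shell mass at the selected depth pair (fibre sums along `keyA₁₃Chi`). [bookkeeping] -/
theorem sum_classSet₁₃Chi_gapShell2A₁₃Chi (K : ℕ) (t : ℝ) :
    ∑ x ∈ classSet₁₃Chi θ χ K₀ g₀ K, gapShell2A₁₃Chi θ χ hP K₀ g₀ os ρ ρ' n₁ n₂ K t x =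
      gap2ShellSumA₁₃Chi θ χ hP K₀ g₀ os ρ ρ' K (selDepthA2₁₃Chi θ χ hP K₀ g₀ os ρ (n₁ K) K t) (selDepthB2₁₃Chi θ χ hP K₀ g₀ os ρ' (n₂ K) K t) t := by
  letI : ∀ Kc, DecidableEq (SiteSeqKey F Kc) := fun _ => Classical.decEq _
  exact Finset.sum_fiberwise_of_maps_to (s := Finset.univ) (t := classSet₁₃Chi θ χ K₀ g₀ K) (g := keyA₁₃Chi θ χ K₀ g₀ K)
    (fun s _ => Finset.mem_union_left _ (Finset.mem_image_of_mem _ (Finset.mem_univ s))) _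

/-- run B: the same along `keyB₁₃Chi`. [bookkeeping] -/
theorem sum_classSet₁₃Chi_gapShell2B₁₃Chi (K : ℕ) (t : ℝ) :
    ∑ x ∈ classSet₁₃Chi θ χ K₀ g₀ K, gapShell2B₁₃Chi θ χ hP K₀ g₀ os ρ ρ' n₁ n₂ K t x =
      gap2ShellSumB₁₃Chi θ χ hP K₀ g₀ os ρ ρ' K (selDepthA2₁₃Chi θ χ hP K₀ g₀ os ρ (n₁ K) K t) (selDepthB2₁₃Chi θ χ hP K₀ g₀ os ρ' (n₂ K) K t) t := by
  letI : ∀ Kc, DecidableEq (SiteSeqKey F Kc) := fun _ => Classical.decEq _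
  exact Finset.sum_fiberwise_of_maps_to (s := Finset.univ) (t := classSet₁₃Chi θ χ K₀ g₀ K) (g := keyB₁₃Chi θ χ K₀ g₀ K)
    (fun s' _ => Finset.mem_union_right _ (Finset.mem_image_of_mem _ (Finset.mem_univ s'))) _

/-- ★★★ **N21's OUTPUT SHAPE AT THE DOUBLY-GAPPED χ-CARRIERS — (M1)-FREE, SIGN-FREE.**  At a χ-keyed Stage-13 tuple on the live-selector line, with the dial rows `0 ≤ ρ_K, ρ′_K ≤ 1`
and `Summable (K ↦ 1∕(n₁ K+1) + 1∕(n₂ K+1))` ONLY: `ShellWeightBound 1 (classSet₁₃Chi …) (gapWeight2A₁₃Chi …) (gapWeight2B₁₃Chi …) (gapShell2A₁₃Chi …) (gapShell2B₁₃Chi …)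
(K ↦ 4(2L^m)⁴·(1∕(n₁ K+1) + 1∕(n₂ K+1)))` — every field PROVED.  χ-twin of dag-n21-w7's `shellWeightBound_carriersGap2₁₃_signFree`.
[cite: Balaban1988Convergent, (2.17)–(2.18) p.257, (3.2)–(3.3) p.265; Balaban1989LargeFieldI, p.181 (bookkeeping)] -/
theorem shellWeightBound_carriersGap2₁₃Chi_signFree (E : B12.RunParams → ℝ) (hsel : θ.ppSel = ppSelLiveOfRecord F N θ.ν θ.τ9 E (wOfRecord₉ F N θ.toStage9Params))
    {ρ ρ' : ℕ → ℝ} {n₁ n₂ : ℕ → ℕ} (hρ0 : ∀ K, 0 ≤ ρ K) (hρ1 : ∀ K, ρ K ≤ 1) (hρ'0 : ∀ K, 0 ≤ ρ' K) (hρ'1 : ∀ K, ρ' K ≤ 1)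
    (hn : Summable (fun K => 1 / ((n₁ K : ℝ) + 1) + 1 / ((n₂ K : ℝ) + 1))) :
    ShellWeightBound 1 (classSet₁₃Chi θ χ K₀ g₀) (gapWeight2A₁₃Chi θ χ hP K₀ g₀ os ρ ρ' n₁ n₂) (gapWeight2B₁₃Chi θ χ hP K₀ g₀ os ρ ρ' n₁ n₂)
      (gapShell2A₁₃Chi θ χ hP K₀ g₀ os ρ ρ' n₁ n₂) (gapShell2B₁₃Chi θ χ hP K₀ g₀ os ρ ρ' n₁ n₂)
      (fun K => 4 * (2 * (F.L : ℝ) ^ F.m) ^ 4 * (1 / ((n₁ K : ℝ) + 1) + 1 / ((n₂ K : ℝ) + 1))) := by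
  have hζ0 : ∀ p g k s Pl Ql RS U V', 0 ≤ θ.ζ p g k s Pl Ql RS U V' :=
    fun p g k s Pl Ql RS U V' => zetaOfRecord_nonneg F N θ.ν θ.τ9.M hP.zetaUnity hP.zetaAbs p g k s Pl Ql RS U V'
  have hU : LocalBgMeasurable F N θ.ν := localBgMeasurable F N θ.ν
  have hD : (datumOfRecord₁₃CoPHChi F N θ χ hP).AvgMeasurable := (isPrintedAveraged_datumOfRecord₁₃CoPH_chi F N θ χ hP).avgMeasurable
  have hνbar : 0 ≤ 4 * (2 * (F.L : ℝ) ^ F.m) ^ 4 := by positivity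
  have hconst : ∀ K, 4 * (2 * (F.L : ℝ) ^ F.m) ^ 4 * (1 / (n₁ K + 1 : ℕ) + 1 / (n₂ K + 1 : ℕ)) =
      4 * (2 * (F.L : ℝ) ^ F.m) ^ 4 * (1 / ((n₁ K : ℝ) + 1) + 1 / ((n₂ K : ℝ) + 1)) := fun K => by push_cast; ring
  have hintA : ∀ K k, k < (runA₁₃ F K₀ g₀ K).K → ∀ s : SeqOfRecord F θ.ν θ.τ9.M (histA₁₃Chi θ χ K₀ g₀ K) (runA₁₃ F K₀ g₀ K).K k, ∀ t : ℝ,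
      Integrable (fun U => chiSeqOfRecord F N θ.ν θ.τ9.M (histA₁₃Chi θ χ K₀ g₀ K) (runA₁₃ F K₀ g₀ K).K k s U *
        dressedSlotsOfDatum₉ F N θ.toStage9Params (datumOfRecord₁₃CoPHChi F N θ χ hP) g₀ os t (runA₁₃ F K₀ g₀ K) (histA₁₃Chi θ χ K₀ g₀ K) k s U)
        (fieldMeasure (F.P (runA₁₃ F K₀ g₀ K).K) k (SU N)) :=
    fun K k _ s t => integrable_chi_mul_dressedSlots_of_ppSelLive θ.toStage9Params E hsel hU hP.zetaMeas hζ0 hP.zetaAbs _ hD g₀ os (histA₁₃Chi_zero θ χ K₀ g₀ K) t k s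
  have hintB : ∀ K k, k < (runB₁₃ F K₀ g₀ K).K → ∀ s : SeqOfRecord F θ.ν θ.τ9.M (histB₁₃Chi θ χ K₀ g₀ K) (runB₁₃ F K₀ g₀ K).K k, ∀ t : ℝ,
      Integrable (fun U => chiSeqOfRecord F N θ.ν θ.τ9.M (histB₁₃Chi θ χ K₀ g₀ K) (runB₁₃ F K₀ g₀ K).K k s U *
        dressedSlotsOfDatum₉ F N θ.toStage9Params (datumOfRecord₁₃CoPHChi F N θ χ hP) g₀ os t (runB₁₃ F K₀ g₀ K) (histB₁₃Chi θ χ K₀ g₀ K) k s U)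
        (fieldMeasure (F.P (runB₁₃ F K₀ g₀ K).K) k (SU N)) :=
    fun K k _ s t => integrable_chi_mul_dressedSlots_of_ppSelLive θ.toStage9Params E hsel hU hP.zetaMeas hζ0 hP.zetaAbs _ hD g₀ os (histB₁₃Chi_zero θ χ K₀ g₀ K) t k s
  letI : ∀ Kc, DecidableEq (SiteSeqKey F Kc) := fun _ => Classical.decEq _
  refine
    { nonneg := fun K => mul_nonneg hνbar (by positivity)
      summable := hn.mul_left _
      sh_nonneg_left := fun K t _ x _ => Finset.sum_nonneg fun s _ =>
        topGap2ShellAtLevel_grids_nonneg F N θ.toStage9Params (datumOfRecord₁₃CoPHChi F N θ χ hP) g₀ os (runA₁₃ F K₀ g₀ K) (histA₁₃Chi θ χ K₀ g₀ K) hζ0 hP.zetaMeas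
          hP.zetaAbs (hρ0 K) (hρ1 K) (hρ'0 K) (hρ'1 K) _ _ _ _ t (fun k hk s => hintA K k hk s t) (K₀ + K) rfl s
      sh_le_left := fun K t _ x _ => Finset.sum_le_sum fun s _ =>
        topGap2ShellAtLevel_le F N θ.toStage9Params (datumOfRecord₁₃CoPHChi F N θ χ hP) g₀ os (runA₁₃ F K₀ g₀ K) (histA₁₃Chi θ χ K₀ g₀ K) hζ0 _ _ _ _ _ _ t (K₀ + K) s
      sh_nonneg_right := fun K t _ x _ => Finset.sum_nonneg fun s' _ =>
        topGap2ShellAtLevel_grids_nonneg F N θ.toStage9Params (datumOfRecord₁₃CoPHChi F N θ χ hP) g₀ os (runB₁₃ F K₀ g₀ K) (histB₁₃Chi θ χ K₀ g₀ K) hζ0 hP.zetaMeas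
          hP.zetaAbs (hρ0 K) (hρ1 K) (hρ'0 K) (hρ'1 K) _ _ _ _ t (fun k hk s => hintB K k hk s t) (K₀ + K + 1) rfl s'
      sh_le_right := fun K t _ x _ => Finset.sum_le_sum fun s' _ =>
        topGap2ShellAtLevel_le F N θ.toStage9Params (datumOfRecord₁₃CoPHChi F N θ χ hP) g₀ os (runB₁₃ F K₀ g₀ K) (histB₁₃Chi θ χ K₀ g₀ K) hζ0 _ _ _ _ _ _ t
          (K₀ + K + 1) s'
      left := fun K t _ => ?_
      right := fun K t _ => ?_ }
  · rw [sum_classSet₁₃Chi_gapShell2A₁₃Chi, sum_classSet₁₃Chi_gapWeight2A₁₃Chi_eq_schemeZ θ χ hP K₀ g₀ os _ _ _ _ E hsel, ← hconst K]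
    exact (gap2ShellSum_selDepths_le_signFree_chi K₀ θ χ hP g₀ os E hsel hρ0 hρ1 hρ'0 hρ'1 (n₁ K) (n₂ K) K t).1
  · rw [sum_classSet₁₃Chi_gapShell2B₁₃Chi, sum_classSet₁₃Chi_gapWeight2B₁₃Chi_eq_schemeZ θ χ hP K₀ g₀ os _ _ _ _ E hsel, ← hconst K]
    exact (gap2ShellSum_selDepths_le_signFree_chi K₀ θ χ hP g₀ os E hsel hρ0 hρ1 hρ'0 hρ'1 (n₁ K) (n₂ K) K t).2

end CarriersChi

/-- ★★ **`ShellWeightBound` AT THE DOUBLY-GAPPED χ-READING, (M1)-FREE, SIGN-FREE** — its `l₀, T, A, B, shA, shB` and its CANONICAL `Wsh` (`shellWeightBound_wshInf`); any `Χ K₀ jcut`,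
the dial rows read at the tuple, live line.  χ-twin of dag-n21-w7's `shellWeightBound_crGap2₁₃VAt_signFree`. [cite: Balaban1988Convergent, (3.2)–(3.3) p.265; Balaban1989LargeFieldI, p.181 (bookkeeping)] -/
theorem shellWeightBound_crGap2₁₃VAtCmap_signFree (Χ : (F : T4Family) → Stage13Params F N → ChiSlot F N) (K₀ : ℕ) (jcut : ℕ → ℕ) (ρ ρ' : WidthLetter₁₃CoPHCmap N Χ)
    (n₁ n₂ : DepthLetter₁₃CoPHCmap N Χ) (θ : Stage13HParams F N) (hP : θ.Provisos₁₃CoPHChi F N (Χ F θ.toStage13Params)) (g₀ : ℕ → ℝ) (os : List (ULoop F))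
    (E : B12.RunParams → ℝ) (hsel : θ.ppSel = ppSelLiveOfRecord F N θ.ν θ.τ9 E (wOfRecord₉ F N θ.toStage9Params))
    (hρ0 : ∀ K, 0 ≤ ρ F θ hP g₀ os K) (hρ1 : ∀ K, ρ F θ hP g₀ os K ≤ 1) (hρ'0 : ∀ K, 0 ≤ ρ' F θ hP g₀ os K) (hρ'1 : ∀ K, ρ' F θ hP g₀ os K ≤ 1)
    (hn : Summable (fun K => 1 / ((n₁ F θ hP g₀ os K : ℝ) + 1) + 1 / ((n₂ F θ hP g₀ os K : ℝ) + 1))) :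
    ShellWeightBound (crGap2₁₃VAtCmap Χ K₀ jcut ρ ρ' n₁ n₂ F θ hP g₀ os).l₀ (crGap2₁₃VAtCmap Χ K₀ jcut ρ ρ' n₁ n₂ F θ hP g₀ os).T
      (crGap2₁₃VAtCmap Χ K₀ jcut ρ ρ' n₁ n₂ F θ hP g₀ os).A (crGap2₁₃VAtCmap Χ K₀ jcut ρ ρ' n₁ n₂ F θ hP g₀ os).B (crGap2₁₃VAtCmap Χ K₀ jcut ρ ρ' n₁ n₂ F θ hP g₀ os).shA
      (crGap2₁₃VAtCmap Χ K₀ jcut ρ ρ' n₁ n₂ F θ hP g₀ os).shB (crGap2₁₃VAtCmap Χ K₀ jcut ρ ρ' n₁ n₂ F θ hP g₀ os).Wsh :=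
  shellWeightBound_wshInf (shellWeightBound_carriersGap2₁₃Chi_signFree K₀ θ (Χ F θ.toStage13Params) hP g₀ os E hsel hρ0 hρ1 hρ'0 hρ'1 hn)

/-! ## §4 At the K3ᴬ v8 mirror (`N = 2`): N21's conjunct on the gap-pinned split reading, any cut reading -/

section GapPin

variable (jc : CutReading) (ρ ρ' : WidthLetter₁₃CoPHAx 2) (n₁ n₂ : DepthLetter₁₃CoPHAx 2)

/-- ★★★ **v8's N21 AND N27x CONJUNCTS ON THE GAP-PINNED SPLIT READING — THEOREMS GIVEN THE DIAL ROWS, ANY CUT READING `jc`**: for `cr` with v8's OWN pin `PinnedAtLiveGap2 jc ρ ρ′ n₁ n₂ cr`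
and the off-live pin to `crOneTerm₁₃Ax 0`, and the dial rows `0 ≤ ρ_K, ρ′_K ≤ 1`, `Σ_K (1∕(n₁ K+1) + 1∕(n₂ K+1)) < ∞` at every tuple (v8's `DialRows ρ ρ′ n₁ n₂`): `KeyedShellWeight cr ∧
KeyedExtractionV cr` — on the line §3 at the re-centred reading (`E := EOfRecord₁₃Ax …` = v8's `LiveSel`), off it the one-term reading (✓p813406); N27x by ✓p813745.
[cite: Balaban1988Convergent, (3.2)–(3.3) p.265; Balaban1989LargeFieldI, (0.3)–(0.4) p.176, p.181 (bookkeeping)] -/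
theorem keyedShell_extraction_of_liveGap2Pin {cr : SpineReading} (hon : PinnedAtLiveGap2 jc ρ ρ' n₁ n₂ cr)
    (hoff : ∀ (F : T4Family) (θ : Stage13HParams F 2) (hP : θ.Provisos₁₃CoPHAx F 2) (g₀ : ℕ → ℝ) (os : List (ULoop F)),
      ¬ LiveSel F θ → cr F θ hP g₀ os = crOneTerm₁₃Ax 0 F θ hP g₀ os)
    (hd : DialRows ρ ρ' n₁ n₂) : KeyedShellWeight cr ∧ KeyedExtractionV cr :=
  ⟨keyedShellWeight_of_livePin (crL := fun F θ hP g₀ os => crGap2₁₃VAx (jc F θ hP g₀ os) ρ ρ' n₁ n₂ F θ hP g₀ os) hon hoff fun F θ hP hG _ g₀ os =>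
      shellWeightBound_crGap2₁₃VAtCmap_signFree (fun F => chiβOfRecord₁₃Ax F 2) 0 (jc F θ hP g₀ os) ρ ρ' n₁ n₂ θ hP g₀ os (EOfRecord₁₃Ax F 2 θ.toStage13Params) hG.2
        (fun K => (hd.1 F θ hP g₀ os K).1.1) (fun K => (hd.1 F θ hP g₀ os K).1.2) (fun K => (hd.1 F θ hP g₀ os K).2.1) (fun K => (hd.1 F θ hP g₀ os K).2.2)
        (hd.2 F θ hP g₀ os),
    (keyedExtraction_faces_of_liveGap2Pin jc ρ ρ' n₁ n₂ hon hoff).2⟩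

/-- ★★ **THE GAP-PINNED SPLIT READING AT THE ZERO CUT READING CARRIES v8's PIN, N20, N21 AND N27x CONJUNCTS — FROM THE DIAL ROWS ALONE** (minted by `exists_reading_livePin`; N20
✓p813406, N21 §4, N27x ✓p813745).  What a v8 stub-2 supplier at `jc ≡ 0` takes as `cr`. [cite: Balaban1989LargeFieldII, (1.80) p.384; Balaban1988Convergent, (3.2)–(3.3) p.265 (bookkeeping)] -/
theorem exists_gap2PinnedSplitReading_threeFaces_cutZero (hd : DialRows ρ ρ' n₁ n₂) :
    ∃ cr : SpineReading, PinnedAtLiveGap2 (fun _ _ _ _ _ => fun _ => 0) ρ ρ' n₁ n₂ cr ∧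
      (∀ (F : T4Family) (θ : Stage13HParams F 2) (hP : θ.Provisos₁₃CoPHAx F 2) (g₀ : ℕ → ℝ) (os : List (ULoop F)),
        ¬ LiveSel F θ → cr F θ hP g₀ os = crOneTerm₁₃Ax 0 F θ hP g₀ os) ∧
      KeyedRelWeight cr ∧ KeyedShellWeight cr ∧ KeyedExtractionV cr := by
  obtain ⟨cr, hon, hoff⟩ := exists_reading_livePin (crGap2₁₃VAx (N := 2) (fun _ => 0) ρ ρ' n₁ n₂)
  exact ⟨cr, hon, hoff, keyedRelWeight_of_liveGap2Pin_cutZero ρ ρ' n₁ n₂ hoff hon, keyedShell_extraction_of_liveGap2Pin (fun _ _ _ _ _ => fun _ => 0) ρ ρ' n₁ n₂ hon hoff hd⟩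

end GapPin

/-! ## §5 The stub-2 bill at the zero cut reading: the dial rows + N19′'s core on the live line + node U5's target off it -/

/-- **★★★ THE REGISTERED STUB-2 TEXT FROM THE DIAL ROWS, N19′'s CORE ON THE LIVE LINE AND NODE U5's TARGET OFF IT — THE PIN, N20, N21, N27x PAID BY NAME**: if for every `β` in print's
window and every guarded, K4-faced reading some dials `ρ ρ′ n₁ n₂` carry `DialRows ρ ρ′ n₁ n₂` and, ON THE GUARDED ADMISSIBLE TUPLES OF THE LIVE LINE, N19′'s slot-keyed `NE7.Core` at the
cut-zero doubly-gapped re-centred reading `crGap2₁₃VAx (fun _ ↦ 0) ρ ρ′ n₁ n₂` (good class = ALL of `classSet₁₃Ax`: NE7 proper — NOT PRINTED for `d = 4`), and OFF THE LINE node U5's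
`Target` at the datum under the rates (NOT PRINTED) — BOTH HYPOTHESES, the other lanes' content, asserted for no family — then `K3Skeleton13SepCoPHAxV8.stub_expansion13HV`'s type ∕
`K3AxV8StubTexts.Stub2TextV8` holds (byte for byte).  NO stub is proved here. [cite: Balaban1989LargeFieldII, Thm 1 + (0.1) pp.355–356, (1.80) p.384; King1986, (3.10)–(3.11) p.656 (bookkeeping)] -/
theorem stub2Text_of_dialRows_liveCore_cutZero
    (h : ∀ β : ℝ, 2 / 3 < β → β < 1 →
      ∀ (𝔯 : RateReading13AxP) (ksel : RunSel) (ℓ : LetterReading) (ℓ₃ : T4Family → Node00.NE3Letters₁₁) (g B : T4Family → ℝ),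
        GuardedReadingN16 𝔯 ksel ℓ ℓ₃ g B → KeyedRatesHolderD4V β (rrOfRecord 𝔯 ksel) →
        ∃ (ρ ρ' : WidthLetter₁₃CoPHAx 2) (n₁ n₂ : DepthLetter₁₃CoPHAx 2), DialRows ρ ρ' n₁ n₂ ∧
          (∀ (F : T4Family) (θ : Stage13HParams F 2) (h : θ.Provisos₁₃SepCoPHAx F 2) (v : Revision₁₃Ax F 2 θ h),
            ((θ.ZhUnity F 2 ∧ θ.SlotsNondegenerate₁₃Ax F 2) ∧ LiveSel F θ) → θ.Admissible F 2 →
            B16.EndStatementBPrinted (datumOfRecord₁₃SepCoPHVAx F 2 θ h v).C → DagBinding.EndpointExistence (datumOfRecord₁₃SepCoPHVAx F 2 θ h v).C.toB12 →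
              ForSmallCouplings (datumOfRecord₁₃SepCoPHVAx F 2 θ h v) fun g₀ => ∀ os : List (ULoop F),
                PHolderD4 β (datumOfRecord₁₃SepCoPHVAx F 2 θ h v) (rrOfRecord 𝔯 ksel F θ h.toCore g₀ os) →
                  letI := (crGap2₁₃VAx (fun _ => 0) ρ ρ' n₁ n₂ F θ h.toCore g₀ os).dec
                  ∃ δ : ℕ → ℝ, NE7.Core (crGap2₁₃VAx (fun _ => 0) ρ ρ' n₁ n₂ F θ h.toCore g₀ os).l₀ (crGap2₁₃VAx (fun _ => 0) ρ ρ' n₁ n₂ F θ h.toCore g₀ os).vol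
                    (crGap2₁₃VAx (fun _ => 0) ρ ρ' n₁ n₂ F θ h.toCore g₀ os).T (crGap2₁₃VAx (fun _ => 0) ρ ρ' n₁ n₂ F θ h.toCore g₀ os).Bad
                    (fun K t τ => (crGap2₁₃VAx (fun _ => 0) ρ ρ' n₁ n₂ F θ h.toCore g₀ os).A K t τ - (crGap2₁₃VAx (fun _ => 0) ρ ρ' n₁ n₂ F θ h.toCore g₀ os).shA K t τ)
                    (fun K t τ => (crGap2₁₃VAx (fun _ => 0) ρ ρ' n₁ n₂ F θ h.toCore g₀ os).B K t τ - (crGap2₁₃VAx (fun _ => 0) ρ ρ' n₁ n₂ F θ h.toCore g₀ os).shB K t τ) δ ∧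
                    Summable δ) ∧
          (∀ (F : T4Family) (θ : Stage13HParams F 2) (hP : θ.Provisos₁₃CoPHAx F 2), ((θ.ZhUnity F 2 ∧ θ.SlotsNondegenerate₁₃Ax F 2) ∧ ¬ LiveSel F θ) →
            θ.Admissible F 2 → ∀ (g₀ : ℕ → ℝ) (os : List (ULoop F)), PHolderD4 β (datumOfRecord₁₃CoPHAx F 2 θ hP) (rrOfRecord 𝔯 ksel F θ hP g₀ os) →
              ∃ δ : ℕ → ℝ, NE7.Target ((F.side : ℝ) ^ 4) 1 δ (fun K => T4GenFunBounds.schemeZ ((datumOfRecord₁₃CoPHAx F 2 θ hP).scheme g₀) os (0 + K)))) :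
    ∀ β : ℝ, 2 / 3 < β → β < 1 →
      ∀ (𝔯 : RateReading13AxP) (ksel : RunSel) (ℓ : LetterReading) (ℓ₃ : T4Family → Node00.NE3Letters₁₁) (g B : T4Family → ℝ),
        GuardedReadingN16 𝔯 ksel ℓ ℓ₃ g B → KeyedRatesHolderD4V β (rrOfRecord 𝔯 ksel) →
        ∃ (jc : CutReading) (ρ ρ' : WidthLetter₁₃CoPHAx 2) (n₁ n₂ : DepthLetter₁₃CoPHAx 2) (cr : SpineReading), PinnedAtLiveGap2 jc ρ ρ' n₁ n₂ cr ∧ DialRows ρ ρ' n₁ n₂ ∧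
          KeyedRelWeight cr ∧ KeyedShellWeight cr ∧ KeyedExtractionV cr ∧ KeyedCoreEdgeHolderD4V β cr (rrOfRecord 𝔯 ksel) := by
  intro β hβ hβ' 𝔯 ksel ℓ ℓ₃ g B hg hr
  obtain ⟨ρ, ρ', n₁, n₂, hd, h19, hoff19⟩ := h β hβ hβ' 𝔯 ksel ℓ ℓ₃ g B hg hr
  obtain ⟨cr, hon, hoff⟩ := exists_reading_livePin (crGap2₁₃VAx (N := 2) (fun _ => 0) ρ ρ' n₁ n₂)
  obtain ⟨h21, hx⟩ := keyedShell_extraction_of_liveGap2Pin (fun _ _ _ _ _ => fun _ => 0) ρ ρ' n₁ n₂ hon hoff hd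
  exact ⟨fun _ _ _ _ _ => fun _ => 0, ρ, ρ', n₁, n₂, cr, hon, hd, keyedRelWeight_of_liveGap2Pin_cutZero ρ ρ' n₁ n₂ hoff hon, h21, hx,
    keyedCoreEdgeHolderD4V_of_livePin hon hoff β (rrOfRecord 𝔯 ksel) h19 hoff19⟩

end Summit.QuantumFields.YangMills.Theorems.N21GappedTopPair13CoPH

end
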